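import Literature.NumberTheory.Rogawski1990.SemilocalCharactersLinIndep     -- ★ `ArchTestKc`, ★ `archProjUForm`, `archTr₀` currency
import Literature.NumberTheory.Automorphic.CompactSubgroupBiAverage         -- ★ p827277 (this seat): generic bi-`K`-average, `integratedOperator_biAverage_eq`
import Literature.NumberTheory.Automorphic.ArchTestFunctionConvolution      -- ★ `archExtZero`, `IsArchTestFunction.contDiff_archExtZero`
import Literature.NumberTheory.Automorphic.ArchTestFunctionSpace            -- ★ `IsArchTestFunction.isArchSmooth_of_contDiff_slice`
import Literature.NumberTheory.Automorphic.ArchGardingWhittaker             -- ★ `IsArchTestFunction`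
import Literature.NumberTheory.Automorphic.UnitaryGroupArchTopology         -- ★ instances: `arch` locally compact, second countable
import Literature.NumberTheory.Automorphic.HarishChandraConvolutionGL       -- ★ `locallyCompactSpace_glInf`, `secondCountableTopology_glInf`
import Literature.NumberTheory.Automorphic.GLnAdelicIntegrationFactsProofs  -- ★ `isMulRightInvariant_of_modularCharacterFun_eq_one`
import Literature.Analysis.Calculus.SmoothKernelIntegral                    -- ★ `contDiff_integral_kernel_mul`
import HarnessLib

/-!
# The bi-`K_c`-average of an archimedean test function is in `ArchTestKc` and has the same integrated operator on every `K_c`-trivial globalization —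
# sub-goal (β)(b) of the T1 arch line (Labesse–Langlands 1979, Lemma 6.1 p. 768; Borel–Jacquet 1979 §4.1; Rogawski 1990 §14.2 p. 233)

Topic `NumberTheory/Rogawski1990`; namespace `Literature.NumberTheory.Rogawski1990` (home of ★ `ArchTestKc`).  KERNEL ONLY: theorems, 0 definitions, 0 named facts, 0
`sorry`.  Cell `hodgecm-mathlib`, floor 0, programme P3, typer topic T1 (statement tree of the letter (L2-SA) ★ `SemilocalCharactersLinIndep`, row #85); the ARCH line
`Lines-draft/T1a_ArchCharactersLinIndep.lean` (typ-T1a (g0)) §0 sub-goal `ArchTestKcPackage` (b).  Seat F0P3-p01 (g9).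

THE MATHEMATICS.  `G′_∞ = U(H)(L⁺ ⊗ ℝ) ≤ GL₃(L ⊗ ℝ)` (★ `UnitaryGroup.arch`), `K_c := ker (archProjUForm) ≤ G′_∞` the compact archimedean factor away from `ι` (compact when
`H` is definite at the other places, ★ `isCompact_ker_archProjU21EmbCM_of_posDef` + ★ `archProjUForm_ker`), `μK` the normalised Haar measure of the compact group `K_c`
(left AND right invariant: a compact group is unimodular, ★ `modularCharacter_eq_one_of_mem_isCompact`), `νinf` a Haar measure on `G′_∞`.  For `ψ ∈ C_c(G′_∞)` which is
the restriction of a test function `ψ'` on `GL₃(L ⊗ ℝ)`: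
* §1 the model `g' ↦ ∫_{K_c × K_c} ψ'(k₁ g' k₂) d(μK ⊗ μK)` on `GL₃(L ⊗ ℝ)` is continuous, compactly supported and ARCH-SMOOTH (differentiation under the integral: kernel
  `(M, (P, Q)) ↦ ψ'₀(P g' e^M Q)`, ★ `contDiff_integral_kernel_mul`; the pattern of ★ `isArchSmooth_archConvModel`, p827148);
* §2 `ψ♮ := (g ↦ ∫ ψ(k₁ g k₂)) ∈ ArchTestKc` — the `K_c`-clauses of ★ `ArchTestKc` (stated through ★ `cmCompactFactor` and ★ `archPart`) reduce to bi-`K_c`-invariance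
  (★ `biAverage_mul_left ∕ _mul_right`, p827277) because `archPart (cmCompactFactor) ⊆ K_c`;
* §3 the (b) TEXT of `ArchTestKcPackage` token for token: `∃ ψ♮ ∈ ArchTestKc` with `(ϖ ∘ archProjUForm)(ψ♮) = (ϖ ∘ archProjUForm)(ψ)` for EVERY unitary globalization `ϖ`
  of every class (★ `integratedOperator_biAverage_eq`: `ϖ ∘ archProjUForm` is trivial on `K_c = ker`).
[LabesseLanglands1979, Lemma 6.1 p. 768 («`B` ample»)]; [BorelJacquet1979, §4.1]; [Rogawski1990, §14.2 p. 233]; [DeitmarEchterhoff2014, Lemma 1.6.3].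

## References
* J.-P. Labesse, R. P. Langlands, *L-indistinguishability for SL(2)*, Canad. J. Math. 31 (1979), Lemma 6.1 p. 768 [LabesseLanglands1979].
* A. Borel, H. Jacquet, *Automorphic forms and automorphic representations*, PSPM 33.1 (1979), §4.1 [BorelJacquet1979].
* J. D. Rogawski, *Automorphic Representations of Unitary Groups in Three Variables* (1990), §14.2 p. 233 [Rogawski1990].
* A. Deitmar, S. Echterhoff, *Principles of Harmonic Analysis*, 2nd ed. (2014), Lemma 1.6.3 [DeitmarEchterhoff2014].
-/

set_option autoImplicit false

noncomputable section

open NumberField NumberField.mixedEmbedding IsDedekindDomain MeasureTheory Measure Set Filter Topology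
-- `Classical`: the place subtypes indexing `mixedSpace L` are `Fintype` classically (`NormedCommRing (mixedSpace L)`); `Matrix.Norms.Operator`: the normed ring
-- `M₃(L ⊗ ℝ)`; `ContDiff`: the exponent `∞`; `ComplexOrder`: `Matrix.PosDef` over `ℂ`.
open scoped Matrix ComplexConjugate Classical ContDiff Matrix.Norms.Operator Topology ComplexOrder

namespace Literature.NumberTheory.Rogawski1990

open Literature.NumberTheory.Automorphic Literature.NumberTheory.Automorphic.UnitaryGroup
open Literature.NumberTheory.Automorphic.UnitaryGroup.CotangentForms
open Literature.RepresentationTheory.KonnoKonno2007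

variable (L : Type) [Field L] [NumberField L] [IsCMField L] (ι : L →+* ℂ) (H : Matrix (Fin 3) (Fin 3) L) (T : GL (Fin 3) ℂ)
  (hT : (T : Matrix (Fin 3) (Fin 3) ℂ)ᴴ * H.map ι * (T : Matrix (Fin 3) (Fin 3) ℂ) = Literature.Geometry.ComplexHyperbolic.BallModel.J)

/-! ## §1 The smooth model of a bi-average on `GL₃(L ⊗ ℝ)` -/

section Model

variable {L H}
variable (Kc : Subgroup (UnitaryGroup.arch (↥(maximalRealSubfield L)) L (IsCMField.complexConj L) 3 H))
  [MeasurableSpace Kc] [BorelSpace Kc] (μK : Measure Kc) [IsFiniteMeasure μK]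
  {ψ' : GL (Fin 3) (mixedSpace L) → ℂ}

omit ι T hT in
/-- **The model `g' ↦ ∫ ψ'(k₁ g' k₂) d(μK ⊗ μK)` is continuous** (`K_c` compact; parametric integral over the compact `K_c × K_c`). [cite: DeitmarEchterhoff2014, Lemma 1.6.3] -/
theorem continuous_archBiAverageModel (hKc : IsCompact (Kc : Set (UnitaryGroup.arch (↥(maximalRealSubfield L)) L (IsCMField.complexConj L) 3 H)))
    (hψ'c : Continuous ψ') :
    Continuous fun g' : GL (Fin 3) (mixedSpace L) =>
      ∫ p : Kc × Kc, ψ' (((p.1 : UnitaryGroup.arch (↥(maximalRealSubfield L)) L (IsCMField.complexConj L) 3 H) : GL (Fin 3) (mixedSpace L)) * g' *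
        ((p.2 : UnitaryGroup.arch (↥(maximalRealSubfield L)) L (IsCMField.complexConj L) 3 H) : GL (Fin 3) (mixedSpace L))) ∂(μK.prod μK) := by
  haveI : CompactSpace Kc := isCompact_iff_compactSpace.1 hKc
  haveI : SecondCountableTopology Kc := TopologicalSpace.Subtype.secondCountableTopology _
  haveI : LocallyCompactSpace (GL (Fin 3) (mixedSpace L)) := locallyCompactSpace_glInf 3 L
  haveI : SecondCountableTopology (GL (Fin 3) (mixedSpace L)) := secondCountableTopology_glInf 3 L
  have hFc : Continuous (Function.uncurry fun (g' : GL (Fin 3) (mixedSpace L)) (p : Kc × Kc) =>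
      ψ' (((p.1 : UnitaryGroup.arch (↥(maximalRealSubfield L)) L (IsCMField.complexConj L) 3 H) : GL (Fin 3) (mixedSpace L)) * g' *
        ((p.2 : UnitaryGroup.arch (↥(maximalRealSubfield L)) L (IsCMField.complexConj L) 3 H) : GL (Fin 3) (mixedSpace L)))) :=
    hψ'c.comp ((((continuous_subtype_val.comp continuous_subtype_val).comp (continuous_fst.comp continuous_snd)).mul continuous_fst).mul
      ((continuous_subtype_val.comp continuous_subtype_val).comp (continuous_snd.comp continuous_snd)))
  have h := continuous_parametric_integral_of_continuous (μ := μK.prod μK) hFc isCompact_univ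
  simpa only [Measure.restrict_univ] using h

omit ι T hT [BorelSpace Kc] [IsFiniteMeasure μK] in
/-- **The model has compact support** (inside `K_c · supp ψ' · K_c` read in `GL₃(L ⊗ ℝ)`). [cite: DeitmarEchterhoff2014, Lemma 1.6.3] -/
theorem hasCompactSupport_archBiAverageModel (hKc : IsCompact (Kc : Set (UnitaryGroup.arch (↥(maximalRealSubfield L)) L (IsCMField.complexConj L) 3 H)))
    (hψ's : HasCompactSupport ψ') :
    HasCompactSupport fun g' : GL (Fin 3) (mixedSpace L) =>
      ∫ p : Kc × Kc, ψ' (((p.1 : UnitaryGroup.arch (↥(maximalRealSubfield L)) L (IsCMField.complexConj L) 3 H) : GL (Fin 3) (mixedSpace L)) * g' *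
        ((p.2 : UnitaryGroup.arch (↥(maximalRealSubfield L)) L (IsCMField.complexConj L) 3 H) : GL (Fin 3) (mixedSpace L))) ∂(μK.prod μK) := by
  set C : Set (GL (Fin 3) (mixedSpace L)) :=
    Subtype.val '' (Kc : Set (UnitaryGroup.arch (↥(maximalRealSubfield L)) L (IsCMField.complexConj L) 3 H)) with hC
  have hCc : IsCompact C := hKc.image continuous_subtype_val
  refine HasCompactSupport.intro ((hCc.mul hψ's.isCompact).mul hCc) fun g' hg' => ?_
  refine integral_eq_zero_of_ae (Eventually.of_forall fun p => ?_)
  have h1 : (((p.1 : UnitaryGroup.arch (↥(maximalRealSubfield L)) L (IsCMField.complexConj L) 3 H) : GL (Fin 3) (mixedSpace L))) ∈ C :=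
    ⟨_, p.1.2, rfl⟩
  have h2 : (((p.2 : UnitaryGroup.arch (↥(maximalRealSubfield L)) L (IsCMField.complexConj L) 3 H) : GL (Fin 3) (mixedSpace L))) ∈ C :=
    ⟨_, p.2.2, rfl⟩
  have hCinv : ∀ c ∈ C, c⁻¹ ∈ C := by
    rintro _ ⟨k, hk, rfl⟩
    exact ⟨k⁻¹, Kc.inv_mem hk, by simp only [Subgroup.coe_inv]⟩
  have hnot : (((p.1 : UnitaryGroup.arch (↥(maximalRealSubfield L)) L (IsCMField.complexConj L) 3 H) : GL (Fin 3) (mixedSpace L))) * g' *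
      (((p.2 : UnitaryGroup.arch (↥(maximalRealSubfield L)) L (IsCMField.complexConj L) 3 H) : GL (Fin 3) (mixedSpace L))) ∉ tsupport ψ' := by
    intro hmem
    apply hg'
    refine ⟨_ , Set.mul_mem_mul (hCinv _ h1) hmem, _, hCinv _ h2, ?_⟩
    group
  exact image_eq_zero_of_notMem_tsupport hnot

omit ι T hT in
/-- **The model is ARCH-SMOOTH**: its right exponential slices `M ↦ ∫ ψ'₀(k₁ g' e^M k₂) d(μK ⊗ μK)` (`ψ'₀ = archExtZero ψ'`) are `C^∞` on `M₃(L ⊗ ℝ)` by differentiation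
under the integral sign (★ `contDiff_integral_kernel_mul` with the smooth kernel `(M, (P, Q)) ↦ ψ'₀(P g' e^M Q)`, bounded parameters on the compact `K_c × K_c`, weight `1`),
whence ★ `IsArchTestFunction.isArchSmooth_of_contDiff_slice`. [cite: DeitmarEchterhoff2014, Lemma 1.6.3] -/
theorem isArchSmooth_archBiAverageModel (hKc : IsCompact (Kc : Set (UnitaryGroup.arch (↥(maximalRealSubfield L)) L (IsCMField.complexConj L) 3 H)))
    (hψ' : IsArchTestFunction 3 L ψ') :
    IsArchSmooth (archGroupGL 3 L).carrier.subtype fun g' : GL (Fin 3) (mixedSpace L) =>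
      ∫ p : Kc × Kc, ψ' (((p.1 : UnitaryGroup.arch (↥(maximalRealSubfield L)) L (IsCMField.complexConj L) 3 H) : GL (Fin 3) (mixedSpace L)) * g' *
        ((p.2 : UnitaryGroup.arch (↥(maximalRealSubfield L)) L (IsCMField.complexConj L) 3 H) : GL (Fin 3) (mixedSpace L))) ∂(μK.prod μK) := by
  haveI : CompactSpace Kc := isCompact_iff_compactSpace.1 hKc
  haveI : SecondCountableTopology Kc := TopologicalSpace.Subtype.secondCountableTopology _
  refine IsArchTestFunction.isArchSmooth_of_contDiff_slice fun g' => ?_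
  -- the smooth kernel `A(M, (P, Q)) = ψ'₀(P g' e^M Q)`
  set A : (Matrix (Fin 3) (Fin 3) (mixedSpace L)) × ((Matrix (Fin 3) (Fin 3) (mixedSpace L)) × (Matrix (Fin 3) (Fin 3) (mixedSpace L))) → ℂ :=
    fun p => archExtZero ψ' (p.2.1 * (g' : Matrix (Fin 3) (Fin 3) (mixedSpace L)) * NormedSpace.exp p.1 * p.2.2) with hA
  have hexp : ContDiff ℝ ∞ (NormedSpace.exp : Matrix (Fin 3) (Fin 3) (mixedSpace L) → Matrix (Fin 3) (Fin 3) (mixedSpace L)) :=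
    contDiff_iff_contDiffAt.2 fun x => Literature.Analysis.Calculus.contDiffAt_exp x
  have hAs : ContDiff ℝ ∞ A :=
    hψ'.contDiff_archExtZero.comp ((((contDiff_fst.comp contDiff_snd).mul contDiff_const).mul (hexp.comp contDiff_fst)).mul
      (contDiff_snd.comp contDiff_snd))
  -- the bounded parameters `(k₁, k₂) ↦ (↑k₁, ↑k₂)` on the compact `K_c × K_c`
  let m : Kc × Kc → (Matrix (Fin 3) (Fin 3) (mixedSpace L)) × (Matrix (Fin 3) (Fin 3) (mixedSpace L)) := fun p =>
    ((((p.1 : UnitaryGroup.arch (↥(maximalRealSubfield L)) L (IsCMField.complexConj L) 3 H) : GL (Fin 3) (mixedSpace L)) : Matrix (Fin 3) (Fin 3) (mixedSpace L)),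
     (((p.2 : UnitaryGroup.arch (↥(maximalRealSubfield L)) L (IsCMField.complexConj L) 3 H) : GL (Fin 3) (mixedSpace L)) : Matrix (Fin 3) (Fin 3) (mixedSpace L)))
  have hmc : Continuous m :=
    (((Units.continuous_val.comp continuous_subtype_val).comp continuous_subtype_val).comp continuous_fst).prodMk
      (((Units.continuous_val.comp continuous_subtype_val).comp continuous_subtype_val).comp continuous_snd)
  obtain ⟨R, hR⟩ := (isCompact_univ.image hmc).isBounded.subset_closedBall
    (0 : (Matrix (Fin 3) (Fin 3) (mixedSpace L)) × (Matrix (Fin 3) (Fin 3) (mixedSpace L)))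
  have hmR : ∀ᵐ p ∂(μK.prod μK), ‖m p‖ ≤ R := ae_of_all _ fun p => by
    have h := hR ⟨p, Set.mem_univ _, rfl⟩
    rwa [Metric.mem_closedBall, dist_zero_right] at h
  -- (`M₃ × M₃` with its product topology is pseudo-metrizable: read it on the `Π`-types)
  haveI : TopologicalSpace.PseudoMetrizableSpace ((Matrix (Fin 3) (Fin 3) (mixedSpace L)) × (Matrix (Fin 3) (Fin 3) (mixedSpace L))) :=
    inferInstanceAs (TopologicalSpace.PseudoMetrizableSpace ((Fin 3 → Fin 3 → mixedSpace L) × (Fin 3 → Fin 3 → mixedSpace L)))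
  haveI : FiniteDimensional ℝ ((Matrix (Fin 3) (Fin 3) (mixedSpace L)) × (Matrix (Fin 3) (Fin 3) (mixedSpace L))) :=
    inferInstanceAs (FiniteDimensional ℝ ((Fin 3 → Fin 3 → mixedSpace L) × (Fin 3 → Fin 3 → mixedSpace L)))
  have hm : AEStronglyMeasurable m (μK.prod μK) := hmc.aestronglyMeasurable
  have hF : Integrable (fun _ : Kc × Kc => (1 : ℂ)) (μK.prod μK) := integrable_const _
  have hsmooth := Literature.Analysis.Calculus.contDiff_integral_kernel_mul hAs hm hmR hF
  -- identify with the exponential slice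
  have hident : (fun M : Matrix (Fin 3) (Fin 3) (mixedSpace L) =>
      ∫ p : Kc × Kc, ψ' (((p.1 : UnitaryGroup.arch (↥(maximalRealSubfield L)) L (IsCMField.complexConj L) 3 H) : GL (Fin 3) (mixedSpace L)) * (g' * expGL M) *
        ((p.2 : UnitaryGroup.arch (↥(maximalRealSubfield L)) L (IsCMField.complexConj L) 3 H) : GL (Fin 3) (mixedSpace L))) ∂(μK.prod μK)) =
      fun M => ∫ p, A (M, m p) * (1 : ℂ) ∂(μK.prod μK) := by
    funext M
    refine integral_congr_ae (ae_of_all _ fun p => ?_)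
    simp only [hA, m, mul_one]
    rw [← coe_expGL, ← Units.val_mul, ← Units.val_mul, ← Units.val_mul, archExtZero_coe]
    simp only [mul_assoc]
  rw [hident]
  exact hsmooth

end Model

/-! ## §2 The compact factor `K_c = ker (archProjUForm)` and its normalised Haar measure; bi-averages are in `ArchTestKc` -/

section Arch

include hT in
/-- `K_c = ker (archProjUForm)` is compact when `H` is positive definite at the places `≠ ι` (★ `archProjUForm_ker`, ★ `isCompact_ker_archProjU21EmbCM_of_posDef`).
[cite: BorelJacquet1979, §4.1] -/
theorem isCompact_ker_archProjUForm (hdef : ∀ τ' : L →+* ℂ, InfinitePlace.mk τ' ≠ InfinitePlace.mk ι → (H.map τ').PosDef) :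
    IsCompact ((archProjUForm L ι H T hT).ker : Set (UnitaryGroup.arch (↥(maximalRealSubfield L)) L (IsCMField.complexConj L) 3 H)) := by
  rw [archProjUForm_ker]
  exact isCompact_ker_archProjU21EmbCM_of_posDef L H ι T (formCongr_eq_of_conjTranspose L ι H T hT) hdef

/-- The archimedean part of an element of the compact adelic factor ★ `cmCompactFactor` lies in `K_c = ker (archProjUForm)` (★ `cmCompactFactor_eq`: `Kc = archToAdelic '' ker`,
★ `archPart_archToAdelic`). [cite: BorelJacquet1979, §4.1] -/
theorem archPart_mem_ker_archProjUForm {k : (adelicGroupData (↥(maximalRealSubfield L)) L (IsCMField.complexConj L) 3 H).Adelic}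
    (hk : k ∈ cmCompactFactor L ι H T hT) :
    archPart (↥(maximalRealSubfield L)) L (IsCMField.complexConj L) 3 H k ∈ (archProjUForm L ι H T hT).ker := by
  have hk' : k ∈ ((archProjU21EmbCM L H ι T (formCongr_eq_of_conjTranspose L ι H T hT)).ker.map
      (archToAdelic (↥(maximalRealSubfield L)) L (IsCMField.complexConj L) 3 H)) := by
    rw [← cmCompactFactor_eq]; exact hk
  obtain ⟨a, ha, rfl⟩ := Subgroup.mem_map.1 hk'
  rw [archPart_archToAdelic, archProjUForm_ker]
  exact ha

/-- **`ψ♮ ∈ ArchTestKc`** for `ψ ∈ C_c(G′_∞)` with a test model `ψ'` on `GL₃(L ⊗ ℝ)`, `K_c = ker (archProjUForm)` compact, `μK` a finite measure on `K_c` invariant under left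
and right translations: the smooth model is §1, and the `cmCompactFactor`-clauses of ★ `ArchTestKc` are bi-`K_c`-invariance (★ `biAverage_mul_left ∕ _mul_right`).
[cite: LabesseLanglands1979, Lemma 6.1 p. 768] [cite: Rogawski1990, §14.2 p. 233] -/
theorem archTestKc_biAverage (hKc : IsCompact ((archProjUForm L ι H T hT).ker : Set (UnitaryGroup.arch (↥(maximalRealSubfield L)) L (IsCMField.complexConj L) 3 H)))
    [MeasurableSpace (archProjUForm L ι H T hT).ker] [BorelSpace (archProjUForm L ι H T hT).ker]
    (μK : Measure (archProjUForm L ι H T hT).ker) [IsFiniteMeasure μK] [μK.IsMulLeftInvariant] [μK.IsMulRightInvariant]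
    {ψ : UnitaryGroup.arch (↥(maximalRealSubfield L)) L (IsCMField.complexConj L) 3 H → ℂ}
    {ψ' : GL (Fin 3) (mixedSpace L) → ℂ} (hψ' : IsArchTestFunction 3 L ψ')
    (hψψ' : ∀ k : UnitaryGroup.arch (↥(maximalRealSubfield L)) L (IsCMField.complexConj L) 3 H, ψ k = ψ' (k : GL (Fin 3) (mixedSpace L))) :
    ArchTestKc L ι H T hT fun g => ∫ p : (archProjUForm L ι H T hT).ker × (archProjUForm L ι H T hT).ker,
      ψ ((p.1 : UnitaryGroup.arch (↥(maximalRealSubfield L)) L (IsCMField.complexConj L) 3 H) * g * p.2) ∂(μK.prod μK) := by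
  rw [archTestKc_iff]
  refine ⟨⟨fun g' => ∫ p : (archProjUForm L ι H T hT).ker × (archProjUForm L ι H T hT).ker,
      ψ' (((p.1 : UnitaryGroup.arch (↥(maximalRealSubfield L)) L (IsCMField.complexConj L) 3 H) : GL (Fin 3) (mixedSpace L)) * g' *
        ((p.2 : UnitaryGroup.arch (↥(maximalRealSubfield L)) L (IsCMField.complexConj L) 3 H) : GL (Fin 3) (mixedSpace L))) ∂(μK.prod μK),
      continuous_archBiAverageModel _ μK hKc hψ'.continuous, hasCompactSupport_archBiAverageModel _ μK hKc hψ'.hasCompactSupport,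
      isArchSmooth_archBiAverageModel _ μK hKc hψ', fun k => ?_⟩, fun k hk a => ?_, fun k hk a => ?_⟩
  · refine integral_congr_ae (ae_of_all _ fun p => ?_)
    simp only [hψψ', Subgroup.coe_mul]
  · exact biAverage_mul_right _ μK ψ (archPart_mem_ker_archProjUForm L ι H T hT hk) a
  · exact biAverage_mul_left _ μK ψ (archPart_mem_ker_archProjUForm L ι H T hT hk) a

/-! ## §3 Sub-goal (β)(b): the bi-`K_c`-average with the same integrated operator on every `K_c`-trivial unitary globalization -/

/-- **(β)(b) — every `ψ ∈ C_c(G′_∞)` with a smooth compactly supported model on `GL₃(L ⊗ ℝ)` has a bi-`K_c`-average `ψ♮ ∈ ArchTestKc` with the SAME integrated operator on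
every unitary globalization pulled back along `archProjUForm`** (these are trivial on `K_c = ker`): `ψ♮(g) = ∫_{K_c × K_c} ψ(k₁ g k₂)` for the normalised Haar measure of the
compact group `K_c` (probability, left and right invariant — a compact group is unimodular), §2 for membership, ★ `integratedOperator_biAverage_eq` for the operator.
The statement is conjunct (b) of `ArchTestKcPackage` (§0 of the T1 arch line) token for token, under its `letI := borel _`, its guard `hdef` and its `hν`.
[cite: LabesseLanglands1979, Lemma 6.1 p. 768] [cite: BorelJacquet1979, §4.1] [cite: Rogawski1990, §14.2 p. 233] -/
theorem archTestKc_biAverage_package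
    (νinf : @Measure (UnitaryGroup.arch (↥(maximalRealSubfield L)) L (IsCMField.complexConj L) 3 H) (borel _))
    (hdef : ∀ τ' : L →+* ℂ, InfinitePlace.mk τ' ≠ InfinitePlace.mk ι → (H.map τ').PosDef)
    (hν : @Measure.IsHaarMeasure _ _ _ (borel _) νinf) :
    letI : MeasurableSpace (UnitaryGroup.arch (↥(maximalRealSubfield L)) L (IsCMField.complexConj L) 3 H) := borel _
    haveI : BorelSpace (UnitaryGroup.arch (↥(maximalRealSubfield L)) L (IsCMField.complexConj L) 3 H) := ⟨rfl⟩
    ∀ ψ : UnitaryGroup.arch (↥(maximalRealSubfield L)) L (IsCMField.complexConj L) 3 H → ℂ, ∀ (hψc : Continuous ψ) (hψs : HasCompactSupport ψ),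
      (∃ ψ' : GL (Fin 3) (NumberField.mixedEmbedding.mixedSpace L) → ℂ, Continuous ψ' ∧ HasCompactSupport ψ' ∧
          IsArchSmooth (archGroupGL 3 L).carrier.subtype ψ' ∧
          ∀ k : UnitaryGroup.arch (↥(maximalRealSubfield L)) L (IsCMField.complexConj L) 3 H,
            ψ k = ψ' (k : GL (Fin 3) (NumberField.mixedEmbedding.mixedSpace L))) →
      ∃ (ψn : UnitaryGroup.arch (↥(maximalRealSubfield L)) L (IsCMField.complexConj L) 3 H → ℂ) (hψn : ArchTestKc L ι H T hT ψn),
        ∀ (x : GKIrrClass (uFormGroup (Fin 2) (Fin 1)))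
          (E : Type) [NormedAddCommGroup E] [InnerProductSpace ℂ E] [CompleteSpace E]
          (ϖ : ContRepresentation ℂ (uFormGroup (Fin 2) (Fin 1)).carrier E) (hϖ : IsUnitaryGlobalization (uFormGroup (Fin 2) (Fin 1)) x ϖ),
          (ϖ.restrict (archProjUForm L ι H T hT)).integratedOperator (hϖ.isUnitary.restrict _)
              (hϖ.isStronglyContinuous.restrict _ (continuous_archProjUForm L ι H T hT)) νinf ⟨⟨ψn, hψn.continuous⟩, hψn.hasCompactSupport⟩ =
            (ϖ.restrict (archProjUForm L ι H T hT)).integratedOperator (hϖ.isUnitary.restrict _)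
              (hϖ.isStronglyContinuous.restrict _ (continuous_archProjUForm L ι H T hT)) νinf ⟨⟨ψ, hψc⟩, hψs⟩ := by
  letI : MeasurableSpace (UnitaryGroup.arch (↥(maximalRealSubfield L)) L (IsCMField.complexConj L) 3 H) := borel _
  haveI : BorelSpace (UnitaryGroup.arch (↥(maximalRealSubfield L)) L (IsCMField.complexConj L) 3 H) := ⟨rfl⟩
  haveI := hν
  intro ψ hψc hψs hψ'
  obtain ⟨ψ', hψ'c, hψ's, hψ'sm, hψψ'⟩ := hψ'
  -- the compact group `K_c` and its normalised Haar measure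
  set Kc : Subgroup (UnitaryGroup.arch (↥(maximalRealSubfield L)) L (IsCMField.complexConj L) 3 H) := (archProjUForm L ι H T hT).ker with hKc_def
  have hKc : IsCompact (Kc : Set (UnitaryGroup.arch (↥(maximalRealSubfield L)) L (IsCMField.complexConj L) 3 H)) :=
    isCompact_ker_archProjUForm L ι H T hT hdef
  haveI : CompactSpace Kc := isCompact_iff_compactSpace.1 hKc
  haveI : SecondCountableTopology Kc := TopologicalSpace.Subtype.secondCountableTopology _
  letI : MeasurableSpace Kc := borel _
  haveI : BorelSpace Kc := ⟨rfl⟩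
  set μK : Measure Kc := Measure.haarMeasure ⊤ with hμK
  haveI : IsProbabilityMeasure μK :=
    ⟨by rw [hμK, ← TopologicalSpace.PositiveCompacts.coe_top]; exact Measure.haarMeasure_self⟩
  haveI : μK.IsMulRightInvariant :=
    isMulRightInvariant_of_modularCharacterFun_eq_one (fun g => modularCharacter_eq_one_of_mem_isCompact (K := (⊤ : Subgroup Kc))
      (by simpa using isCompact_univ (X := Kc)) (Subgroup.mem_top g)) μK
  -- the bi-average and its membership
  have hmem := archTestKc_biAverage L ι H T hT hKc μK ⟨hψ'c, hψ's, hψ'sm⟩ hψψ'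
  refine ⟨_, hmem, fun x E _ _ _ ϖ hϖ => ?_⟩
  refine integratedOperator_biAverage_eq Kc μK νinf hKc _ _ (fun k hk w => ?_) ⟨⟨ψ, hψc⟩, hψs⟩ _ (fun g => rfl)
  -- `ϖ ∘ archProjUForm` is trivial on `K_c = ker`
  rw [ContRepresentation.restrict_apply, (MonoidHom.mem_ker).1 hk, map_one]
  rfl

end Arch

end Literature.NumberTheory.Rogawski1990

end
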